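import Literature.Computability.MetaComplexity.TseitinDepthFregeProofs
import Literature.Combinatorics.SimpleGraph.SubcubicMinors
import HarnessLib

/-!
# The GIRS treewidth lower bound from Håstad's grid theorem and the Excluded Grid Theorem

`Literature.Computability.MetaComplexity.galesiEtAl_tseitin_treewidth_depthFrege_lowerBound`
(GIRS, APAL 2023, Thm. 18) is "Thm. 17 [Håstad's grid theorem] + Cor. 9 [from Thm. 8, the
polynomial Excluded Grid Theorem of Chekuri–Chuzhoy / Chuzhoy–Tan] + the reduction of §3".
`TseitinDepthFregeProofs.lean` proves the reduction and assembles the bound from the grid case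
(H′) and a WALL TOPOLOGICAL-minor hypothesis (W_δ). This file replaces (W_δ) by the Excluded Grid
Theorem in the MINOR form in which it is printed, using Diestel's Prop. 1.7.2 (ii) for walls
(`wall_isTopologicalMinor_of_grid_isMinor`, `SubcubicMinors.lean` — this is GIRS Cor. 9):

* `wallForm_of_excludedGridForm` — (EG_δ) "`tw(G) ≥ t₁ ⇒ 𝓗_{g,g} ≼ₘ G` for some `g ≥ c·tw(G)^δ`"
  implies (W_δ).
* `excludedGridForm_of_chuzhoyTanForm` — Chuzhoy–Tan Thm. 1.1 as printed ("there exist constants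
  `c₁, c₂ > 0` such that for every integer `g ≥ 2`, every graph of treewidth at least
  `k = c₁ g⁹ log^{c₂} g` contains the `(g × g)`-grid as a minor"; the `(g × g)`-grid has `g²`
  vertices, i.e. it is `grid (g-1) (g-1)`) implies (EG_{1/10}) with `c = 1/2` (GIRS Thm. 8:
  "`λ ≥ 1/10`"), by the elementary estimate `c₁ (log g)^{c₂} ≤ g` for `g ≥ (c₁ (2c₂)^{c₂})²`.
* `galesiEtAl_tseitin_treewidth_depthFrege_lowerBound_of_grid_of_excludedGrid` — (H′) ∧ (EG_δ) ⇒
  the GIRS bound; `galesiEtAl_tseitin_treewidth_depthFrege_lowerBound_of_hastad_of_chuzhoyTan` —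
  (H) [GIRS Thm. 17 = Håstad, JACM 68 (2021), Thm. 6.5] ∧ (CT) [Chuzhoy–Tan Thm. 1.1] ⇒ the GIRS
  bound. These two hypotheses are exactly the two external theorems the source invokes, each in
  its printed form; neither is in the tree (both are deep: a multi-switching lemma, resp. the
  polynomial grid-minor theorem), so the GIRS fact itself stays undischarged.

All statements are proved; no new facts.

## References

* [GalesiEtAl2023] N. Galesi, D. Itsykson, A. Riazanov, A. Sofronova, *Bounded-depth Frege
  complexity of Tseitin formulas for all graphs*, Ann. Pure Appl. Logic 174 (2023) 103166, Thm. 8,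
  Cor. 9, Thm. 17, Thm. 18 (proof, §3.3). Read: APAL text pp. 10, 15–16.
* [ChuzhoyTan2021] J. Chuzhoy, Z. Tan, *Towards tight(er) bounds for the Excluded Grid Theorem*,
  J. Combin. Theory Ser. B 146 (2021) 219–265, Thm. 1.1. Read: arXiv:1901.07944, p. 3.
* [Diestel2010] R. Diestel, *Graph Theory*, 4th ed., Prop. 1.7.2 (ii).
-/

namespace Literature.Computability.MetaComplexity

open Finset Literature.Combinatorics.SimpleGraph Complexity Complexity.PropForm TextbookFrege

/-! ### From grid minors to wall topological minors -/

/-- (EG_δ) ⇒ (W_δ): if large treewidth forces a large grid MINOR then it forces a large wall as a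
TOPOLOGICAL minor, with the same parameters (`W_g ⊆ 𝓗_{g,g}` has maximum degree `3`; Diestel
Prop. 1.7.2 (ii)). [cite: GalesiEtAl2023, Corollary 9] -/
theorem wallForm_of_excludedGridForm
    (hEG : ∃ δ : ℝ, 0 < δ ∧ ∃ c : ℝ, 0 < c ∧ ∃ t₁ : ℕ, ∀ (V : Type) [Fintype V]
      (G : SimpleGraph V), t₁ ≤ treewidth G →
      ∃ g : ℕ, c * (treewidth G : ℝ) ^ δ ≤ g ∧ grid g g ≼ₘ G) :
    ∃ δ : ℝ, 0 < δ ∧ ∃ c : ℝ, 0 < c ∧ ∃ t₁ : ℕ, ∀ (V : Type) [Fintype V]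
      (G : SimpleGraph V), t₁ ≤ treewidth G →
      ∃ r : ℕ, c * (treewidth G : ℝ) ^ δ ≤ r ∧ wall r ≼ₜ G := by
  obtain ⟨δ, hδ, c, hc, t₁, h⟩ := hEG
  refine ⟨δ, hδ, c, hc, t₁, fun V _ G htw => ?_⟩
  obtain ⟨g, hg, hmin⟩ := h V G htw
  exact ⟨g, hg, wall_isTopologicalMinor_of_grid_isMinor hmin⟩

/-- **GIRS Theorem 18 from the grid case and the Excluded Grid Theorem (minor form, any
exponent).** [cite: GalesiEtAl2023, Theorem 18 (proof, §3.3) with Corollary 9] -/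
theorem galesiEtAl_tseitin_treewidth_depthFrege_lowerBound_of_grid_of_excludedGrid
    (hgrid : ∃ c : ℝ, 0 < c ∧ ∀ d : ℕ, ∃ n₁ : ℕ, ∀ n : ℕ, n₁ ≤ n →
      ∀ (m v : ℕ) (E : Fin m → LinEqMod 2 v), IsGridTseitinSystem n E →
      ∀ π : List (PropForm ℕ),
        textbookFrege.IsDepthProofOf d π (neg (PropForm.ofCNF (sumEncoding 1 E))) →
        (2 : ℝ) ^ ((n : ℝ) ^ (c / d)) ≤ (proofSize π : ℝ))
    (hEG : ∃ δ : ℝ, 0 < δ ∧ ∃ c : ℝ, 0 < c ∧ ∃ t₁ : ℕ, ∀ (V : Type) [Fintype V]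
      (G : SimpleGraph V), t₁ ≤ treewidth G →
      ∃ g : ℕ, c * (treewidth G : ℝ) ^ δ ≤ g ∧ grid g g ≼ₘ G) :
    galesiEtAl_tseitin_treewidth_depthFrege_lowerBound :=
  galesiEtAl_tseitin_treewidth_depthFrege_lowerBound_of_grid_of_wall hgrid
    (wallForm_of_excludedGridForm hEG)

/-! ### Chuzhoy–Tan's form of the Excluded Grid Theorem -/

namespace TseitinNumerics

/-- `c₁ (log g)^{c₂} ≤ g` once `g ≥ (c₁ (2c₂)^{c₂})²` (and `g ≥ 1`): from `log g ≤ 2c₂ · g^{1/(2c₂)}`.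
[folklore] -/
theorem log_rpow_le_self {c₁ c₂ g : ℝ} (hc₁ : 0 < c₁) (hc₂ : 0 < c₂) (hg1 : 1 ≤ g)
    (hg : (c₁ * (2 * c₂) ^ c₂) ^ 2 ≤ g) : c₁ * Real.log g ^ c₂ ≤ g := by
  have hg0 : 0 < g := by linarith
  have hlog0 : 0 ≤ Real.log g := Real.log_nonneg hg1
  set A : ℝ := c₁ * (2 * c₂) ^ c₂ with hA
  have hA0 : 0 < A := by positivity
  -- log g ≤ (2 c₂) g^{1/(2c₂)}
  have h1 : Real.log g ≤ (2 * c₂) * g ^ (1 / (2 * c₂)) := by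
    have := Real.log_le_rpow_div hg0.le (by positivity : 0 < 1 / (2 * c₂))
    rw [div_div_eq_mul_div, div_one] at this
    linarith
  have h2 : Real.log g ^ c₂ ≤ (2 * c₂) ^ c₂ * g ^ (1 / 2 : ℝ) := by
    calc Real.log g ^ c₂ ≤ ((2 * c₂) * g ^ (1 / (2 * c₂))) ^ c₂ :=
          Real.rpow_le_rpow hlog0 h1 hc₂.le
      _ = (2 * c₂) ^ c₂ * (g ^ (1 / (2 * c₂))) ^ c₂ :=
          Real.mul_rpow (by positivity) (Real.rpow_nonneg hg0.le _)
      _ = (2 * c₂) ^ c₂ * g ^ (1 / 2 : ℝ) := by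
          rw [← Real.rpow_mul hg0.le]
          congr 2
          field_simp
  -- √g ≥ A
  have h3 : A ≤ g ^ (1 / 2 : ℝ) := by
    calc A = (A ^ 2) ^ (1 / 2 : ℝ) := by
          rw [← Real.sqrt_eq_rpow, Real.sqrt_sq hA0.le]
      _ ≤ g ^ (1 / 2 : ℝ) := Real.rpow_le_rpow (by positivity) hg (by norm_num)
  have hgg : g ^ (1 / 2 : ℝ) * g ^ (1 / 2 : ℝ) = g := by
    rw [← Real.rpow_add hg0]; norm_num
  calc c₁ * Real.log g ^ c₂ ≤ c₁ * ((2 * c₂) ^ c₂ * g ^ (1 / 2 : ℝ)) :=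
        mul_le_mul_of_nonneg_left h2 hc₁.le
    _ = A * g ^ (1 / 2 : ℝ) := by rw [hA]; ring
    _ ≤ g ^ (1 / 2 : ℝ) * g ^ (1 / 2 : ℝ) :=
        mul_le_mul_of_nonneg_right h3 (Real.rpow_nonneg hg0.le _)
    _ = g := hgg

end TseitinNumerics

/-- **Chuzhoy–Tan's Excluded Grid Theorem gives (EG_{1/10}).** If (CT) "there exist constants
`c₁, c₂ > 0` such that for every integer `g ≥ 2`, every graph of treewidth at least
`c₁ g⁹ log^{c₂} g` contains the `(g × g)`-grid as a minor" (the `(g × g)`-grid is `grid (g-1) (g-1)`,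
`g²` vertices), then there is `t₁` such that every finite graph `G` with `tw(G) ≥ t₁` contains
`𝓗_{r,r}` as a minor for some `r ≥ tw(G)^{1/10} / 2` (GIRS Thm. 8: "`r = Ω(t^λ)`, `λ ≥ 1/10`"):
take `g = ⌊tw(G)^{1/10}⌋`, so that `c₁ g⁹ (log g)^{c₂} ≤ g^{10} ≤ tw(G)` for `g` large
(`TseitinNumerics.log_rpow_le_self`). [cite: GalesiEtAl2023, Theorem 8; ChuzhoyTan2021, Theorem 1.1] -/
theorem excludedGridForm_of_chuzhoyTanForm
    (hCT : ∃ c₁ : ℝ, 0 < c₁ ∧ ∃ c₂ : ℝ, 0 < c₂ ∧ ∀ g : ℕ, 2 ≤ g →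
      ∀ (V : Type) [Fintype V] (G : SimpleGraph V),
        c₁ * (g : ℝ) ^ 9 * Real.log g ^ c₂ ≤ treewidth G → grid (g - 1) (g - 1) ≼ₘ G) :
    ∃ δ : ℝ, 0 < δ ∧ ∃ c : ℝ, 0 < c ∧ ∃ t₁ : ℕ, ∀ (V : Type) [Fintype V]
      (G : SimpleGraph V), t₁ ≤ treewidth G →
      ∃ g : ℕ, c * (treewidth G : ℝ) ^ δ ≤ g ∧ grid g g ≼ₘ G := by
  obtain ⟨c₁, hc₁, c₂, hc₂, hCT⟩ := hCT
  set A : ℝ := c₁ * (2 * c₂) ^ c₂ with hA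
  set M : ℝ := max 4 (A ^ 2) + 1 with hM
  have hM0 : 0 ≤ M := by have := le_max_left 4 (A ^ 2); linarith
  refine ⟨1 / 10, by norm_num, 1 / 2, by norm_num, ⌈M ^ (10 : ℝ)⌉₊, fun V _ G htw => ?_⟩
  set t : ℝ := (treewidth G : ℝ) with ht
  have ht0 : 0 ≤ t := Nat.cast_nonneg _
  have hMt : M ^ (10 : ℝ) ≤ t := Nat.ceil_le.1 htw
  -- s = t^{1/10} ≥ M
  set s : ℝ := t ^ (1 / 10 : ℝ) with hs
  have hs0 : 0 ≤ s := Real.rpow_nonneg ht0 _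
  have hMs : M ≤ s := by
    calc M = (M ^ (10 : ℝ)) ^ (1 / 10 : ℝ) := by rw [← Real.rpow_mul hM0]; norm_num
      _ ≤ s := Real.rpow_le_rpow (Real.rpow_nonneg hM0 _) hMt (by norm_num)
  have hs10 : s ^ (10 : ℕ) = t := by
    rw [← Real.rpow_natCast, hs, ← Real.rpow_mul ht0]; norm_num
  -- g = ⌊s⌋
  set g : ℕ := ⌊s⌋₊ with hg
  have hgs : (g : ℝ) ≤ s := Nat.floor_le hs0
  have hsg : s < g + 1 := Nat.lt_floor_add_one s
  have hg4 : (4 : ℝ) ≤ g := by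
    have := le_max_left 4 (A ^ 2); linarith
  have hgA : A ^ 2 ≤ g := by
    have := le_max_right 4 (A ^ 2); linarith
  have hg2 : 2 ≤ g := by exact_mod_cast (show (2 : ℝ) ≤ g by linarith)
  have hg1 : (1 : ℝ) ≤ g := by linarith
  -- the treewidth hypothesis of (CT) at this `g`
  have hlog : c₁ * Real.log g ^ c₂ ≤ g := TseitinNumerics.log_rpow_le_self hc₁ hc₂ hg1 hgA
  have hpow : (g : ℝ) ^ 10 ≤ t := by
    rw [← hs10]
    exact pow_le_pow_left₀ (by positivity) hgs 10
  have hCT' : c₁ * (g : ℝ) ^ 9 * Real.log g ^ c₂ ≤ treewidth G := by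
    calc c₁ * (g : ℝ) ^ 9 * Real.log g ^ c₂ = (g : ℝ) ^ 9 * (c₁ * Real.log g ^ c₂) := by ring
      _ ≤ (g : ℝ) ^ 9 * g := mul_le_mul_of_nonneg_left hlog (by positivity)
      _ = (g : ℝ) ^ 10 := by ring
      _ ≤ t := hpow
  refine ⟨g - 1, ?_, hCT g hg2 V G hCT'⟩
  -- (1/2) t^{1/10} ≤ g - 1
  have hg1' : 1 ≤ g := by omega
  rw [Nat.cast_sub hg1', Nat.cast_one]
  change 1 / 2 * s ≤ (g : ℝ) - 1
  linarith

/-- **GIRS Theorem 18 from its two printed inputs**: Håstad's grid theorem in the form (H) of GIRS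
Thm. 17 ("there is a constant `K > 0` such that for `d ≤ K log n / log log n` any depth-`d`
derivation of `¬T(𝓗_{n,n}, f)` has size at least `2^{n^{Ω(1/d)}}`" [Håstad, JACM 68 (2021),
Thm. 6.5]) and the Excluded Grid Theorem in the form (CT) of Chuzhoy–Tan Thm. 1.1 (= GIRS Thm. 8).
[cite: GalesiEtAl2023, Theorem 18 (proof, §3.3), Theorem 17, Theorem 8, Corollary 9] -/
theorem galesiEtAl_tseitin_treewidth_depthFrege_lowerBound_of_hastad_of_chuzhoyTan
    (hgrid : ∃ K : ℝ, 0 < K ∧ ∃ c : ℝ, 0 < c ∧ ∃ n₀ : ℕ, ∀ n : ℕ, n₀ ≤ n → ∀ d : ℕ,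
      (d : ℝ) ≤ K * Real.log n / Real.log (Real.log n) →
      ∀ (m v : ℕ) (E : Fin m → LinEqMod 2 v), IsGridTseitinSystem n E →
      ∀ π : List (PropForm ℕ),
        textbookFrege.IsDepthProofOf d π (neg (PropForm.ofCNF (sumEncoding 1 E))) →
        (2 : ℝ) ^ ((n : ℝ) ^ (c / d)) ≤ (proofSize π : ℝ))
    (hCT : ∃ c₁ : ℝ, 0 < c₁ ∧ ∃ c₂ : ℝ, 0 < c₂ ∧ ∀ g : ℕ, 2 ≤ g →
      ∀ (V : Type) [Fintype V] (G : SimpleGraph V),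
        c₁ * (g : ℝ) ^ 9 * Real.log g ^ c₂ ≤ treewidth G → grid (g - 1) (g - 1) ≼ₘ G) :
    galesiEtAl_tseitin_treewidth_depthFrege_lowerBound :=
  galesiEtAl_tseitin_treewidth_depthFrege_lowerBound_of_grid_of_excludedGrid
    (gridBound_of_hastadForm hgrid) (excludedGridForm_of_chuzhoyTanForm hCT)

end Literature.Computability.MetaComplexity
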